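import Literature.NumberTheory.LFunctions.KloostermanFractionsReciprocity
import HarnessLib

/-!
# Bilinear forms with Kloosterman fractions: no twisted estimates are needed (untwisting at cost `(1+|X|/MN)^{1/2}`)

Topic `NumberTheory/LFunctions`.  For the named fact
`DukeFriedlanderIwaniec1997_bilinearKloostermanFractions` (`DeterminantEquationDFI.lean`) along
Bettin–Chandee, *Trilinear forms with Kloosterman fractions*, Adv. Math. 328 (2018), the range
`M < N` is reached from `M ≥ N` by reciprocity, which introduces the twist `e(k/mn)`; the source
handles it by re-running §§3–6 with the twist inserted (Remark 2, exponent `1/2`).  This file PROVES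
that this is unnecessary: the box splitting of Duke–Friedlander–Iwaniec (LMS LNS 237, p. 111; the
tree's `DFI_box_bound`) removes any twist `e(X/mn)` at the cost `(1 + |X|/MN)^{1/2}` (keeping the
sharp count of boxes), and the resulting exponent `1/2 + 1/4 = 3/4` in `(1 + |k|/MN)` still fits
under Duke–Friedlander–Iwaniec's `(|k| + MN)^{3/8}(M+N)^{11/48+ε}` in every range where the trivial
bound does not (margin `(M+N)^{-1/120}` in logarithmic coordinates).

* `DFI_twisted_le_of_untwisted` — twisted `≤ 2e^{2π} K (1 + |X|/MN)^{1/2} P₁P₂ ‖α‖‖β‖` from an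
  untwisted bound `K ‖α‖‖β‖ P₁ P₂` valid for all coefficients in the box;
* `DFI_shape_of_BC34_and_trivial` — the range bookkeeping of `KloostermanFractionsDFIfromBC.lean`
  with the hypothesis exponent `3/4` instead of `1/2`;
* **`DFI_untwisted_allMN_of_BC71_MgeN`** — Bettin–Chandee (7.1) (case `A = 1`, UNtwisted) in the
  range `1/2 ≤ N ≤ M` ⟹ the untwisted Duke–Friedlander–Iwaniec bound in all ranges;
* **`DukeFriedlanderIwaniec1997_bilinearKloostermanFractions_of_BC71_MgeN`** — ⟹ the named fact
  (through the tree's `…_of_untwisted`).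

Consequently the remaining input for the named fact is Bettin–Chandee §§2–6 for the UNTWISTED
second moment (`kfC` of `KloostermanFractionsAmplifiedForm.lean`) in the range `M ≥ N` only.

## References

* S. Bettin, V. Chandee, Adv. Math. 328 (2018) 1234–1262 (arXiv:1502.00769), §7 ((7.1), (7.2),
  Remark 2). [BettinChandee2018]
* W. Duke, J. Friedlander, H. Iwaniec, LMS Lecture Note Ser. 237 (1997), p. 111 (separation of
  variables). [DukeFriedlanderIwaniec1997Determinant]
* W. Duke, J. Friedlander, H. Iwaniec, Invent. Math. 128 (1997) 23–43, Theorem 2.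
  [DukeFriedlanderIwaniec1997]
-/

noncomputable section

open Finset Real Complex

namespace Literature.NumberTheory.LFunctions

/-- **Removing the twist `e(X/mn)` at the cost `(1 + |X|/MN)^{1/2}`.**  If at the box
`(M,2M] × (N,2N]` and numerator `k` the untwisted bilinear form obeys
`|∑∑_{(m,n)=1} α_m β_n e(k m̄/n)| ≤ K ‖α‖‖β‖ P₁ P₂` for ALL coefficient sequences supported in the
box, then for every real `X`,
`|∑∑_{(m,n)=1} α_m β_n e(k m̄/n + X/mn)| ≤ 2 e^{2π} K (1 + |X|/MN)^{1/2} P₁ P₂ ‖α‖‖β‖`.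
Same box splitting as `DukeFriedlanderIwaniec1997_bilinearKloostermanFractions_of_untwisted`
(`DFI_box_bound` on `L²` boxes, `L = ⌊(|X|/MN)^{1/2}⌋ + 1`), but keeping the sharper count
`L ≤ 1 + (|X|/MN)^{1/2} ≤ √2 (1 + |X|/MN)^{1/2}` (the tree's version records `L ≤ 2(1 + |X|/MN)`).
[cite: DukeFriedlanderIwaniec1997Determinant, Proof of Proposition, p. 111] -/
theorem DFI_twisted_le_of_untwisted {M N : ℝ} (hM : 1 / 2 ≤ M) (hN : 1 / 2 ≤ N) {k : ℤ}
    {K P₁ P₂ : ℝ} (hK : 0 ≤ K) (hP₁ : 0 ≤ P₁) (hP₂ : 0 ≤ P₂)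
    (hB : ∀ (α β : ℕ → ℂ),
        (∀ m : ℕ, α m ≠ 0 → M < m ∧ (m : ℝ) ≤ 2 * M) →
        (∀ n : ℕ, β n ≠ 0 → N < n ∧ (n : ℝ) ≤ 2 * N) →
        ‖∑ m ∈ Finset.Icc 1 ⌊2 * M⌋₊, ∑ n ∈ Finset.Icc 1 ⌊2 * N⌋₊,
            if Nat.Coprime m n then
              α m * β n * cexp (2 * π * I *
                ((k : ℂ) * ((((m : ZMod n)⁻¹).val : ℕ) : ℂ) / (n : ℂ)))
            else 0‖ ≤
          K * √(∑ m ∈ Finset.Icc 1 ⌊2 * M⌋₊, ‖α m‖ ^ 2) *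
            √(∑ n ∈ Finset.Icc 1 ⌊2 * N⌋₊, ‖β n‖ ^ 2) * P₁ * P₂)
    (X : ℝ) (α β : ℕ → ℂ)
    (hα : ∀ m : ℕ, α m ≠ 0 → M < m ∧ (m : ℝ) ≤ 2 * M)
    (hβ : ∀ n : ℕ, β n ≠ 0 → N < n ∧ (n : ℝ) ≤ 2 * N) :
    ‖∑ m ∈ Finset.Icc 1 ⌊2 * M⌋₊, ∑ n ∈ Finset.Icc 1 ⌊2 * N⌋₊,
        if Nat.Coprime m n then
          α m * β n * cexp (2 * π * I *
            ((k : ℂ) * ((((m : ZMod n)⁻¹).val : ℕ) : ℂ) / (n : ℂ) + (X : ℂ) / ((m : ℂ) * n)))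
        else 0‖ ≤
      2 * Real.exp (2 * π) * K * (1 + |X| / (M * N)) ^ (1 / 2 : ℝ) * P₁ * P₂ *
        √(∑ m ∈ Finset.Icc 1 ⌊2 * M⌋₊, ‖α m‖ ^ 2) *
        √(∑ n ∈ Finset.Icc 1 ⌊2 * N⌋₊, ‖β n‖ ^ 2) := by
  have hM0 : (0 : ℝ) < M := by linarith
  have hN0 : (0 : ℝ) < N := by linarith
  set Y : ℝ := |X| / (M * N) with hY
  have hY0 : 0 ≤ Y := by positivity
  -- the number of boxes in each variable
  set L : ℕ := ⌊√Y⌋₊ + 1 with hL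
  have hL0 : 0 < L := Nat.succ_pos _
  have hLr : (0 : ℝ) < L := by exact_mod_cast hL0
  have hLY : √Y < L := by
    rw [hL]; push_cast
    exact Nat.lt_floor_add_one _
  have hYL : Y / (L : ℝ) ^ 2 ≤ 1 := by
    rw [div_le_one (by positivity)]
    calc Y = (√Y) ^ 2 := (Real.sq_sqrt hY0).symm
      _ ≤ (L : ℝ) ^ 2 := by gcongr
  -- the sharper count `L ≤ √2 (1 + Y)^{1/2}`
  have hL2 : (L : ℝ) ≤ 2 * (1 + Y) ^ (1 / 2 : ℝ) := by
    have h1 : (L : ℝ) = ⌊√Y⌋₊ + 1 := by rw [hL]; push_cast; ring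
    have h2 : (⌊√Y⌋₊ : ℝ) ≤ √Y := Nat.floor_le (Real.sqrt_nonneg _)
    have h3 : √Y + 1 ≤ 2 * √(1 + Y) := by
      have h4 : √Y ≤ √(1 + Y) := Real.sqrt_le_sqrt (by linarith)
      have h5 : 1 ≤ √(1 + Y) := by
        have h6 : √1 ≤ √(1 + Y) := Real.sqrt_le_sqrt (by linarith)
        rwa [Real.sqrt_one] at h6
      linarith
    rw [← Real.sqrt_eq_rpow]
    linarith
  set bM := Finset.Icc 1 ⌊2 * M⌋₊ with hbM
  set bN := Finset.Icc 1 ⌊2 * N⌋₊ with hbN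
  have hmapM : ∀ m ∈ bM, ⌈(((m : ℕ) : ℝ) - M) * L / M⌉₊ - 1 ∈ Finset.range L := by
    intro m hm
    rw [Finset.mem_range]
    refine DFI_idx_lt hM0 hL0 ?_
    have h1 : (m : ℝ) ≤ ⌊2 * M⌋₊ := by exact_mod_cast (Finset.mem_Icc.mp hm).2
    exact h1.trans (Nat.floor_le (by positivity))
  have hmapN : ∀ n ∈ bN, ⌈(((n : ℕ) : ℝ) - N) * L / N⌉₊ - 1 ∈ Finset.range L := by
    intro n hn
    rw [Finset.mem_range]
    refine DFI_idx_lt hN0 hL0 ?_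
    have h1 : (n : ℝ) ≤ ⌊2 * N⌋₊ := by exact_mod_cast (Finset.mem_Icc.mp hn).2
    exact h1.trans (Nat.floor_le (by positivity))
  -- the summand
  set F : ℕ → ℕ → ℂ := fun m n => if Nat.Coprime m n then
      α m * β n * cexp (2 * π * I *
        ((k : ℂ) * ((((m : ZMod n)⁻¹).val : ℕ) : ℂ) / (n : ℂ) + (X : ℂ) / ((m : ℂ) * n)))
    else 0 with hF
  -- decomposition into boxes
  have hdec : ∑ m ∈ bM, ∑ n ∈ bN, F m n =
      ∑ i ∈ Finset.range L, ∑ j ∈ Finset.range L,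
        ∑ m ∈ bM with ⌈(((m : ℕ) : ℝ) - M) * L / M⌉₊ - 1 = i,
          ∑ n ∈ bN with ⌈(((n : ℕ) : ℝ) - N) * L / N⌉₊ - 1 = j, F m n := by
    rw [← Finset.sum_fiberwise_of_maps_to hmapM]
    refine Finset.sum_congr rfl fun i _ => ?_
    rw [Finset.sum_comm, ← Finset.sum_fiberwise_of_maps_to hmapN]
    refine Finset.sum_congr rfl fun j _ => ?_
    exact Finset.sum_comm
  -- box bounds
  have hbox : ∀ i j : ℕ,
      ‖∑ m ∈ bM with ⌈(((m : ℕ) : ℝ) - M) * L / M⌉₊ - 1 = i,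
          ∑ n ∈ bN with ⌈(((n : ℕ) : ℝ) - N) * L / N⌉₊ - 1 = j, F m n‖ ≤
        Real.exp (2 * π) * K * P₁ * P₂ *
          (√(∑ m ∈ bM with ⌈(((m : ℕ) : ℝ) - M) * L / M⌉₊ - 1 = i, ‖α m‖ ^ 2) *
            √(∑ n ∈ bN with ⌈(((n : ℕ) : ℝ) - N) * L / N⌉₊ - 1 = j, ‖β n‖ ^ 2)) :=
    fun i j => DFI_box_bound hM0 hN0 hK hP₁ hP₂ hα hβ hB hL0 hYL i j
  -- Cauchy–Schwarz over the boxes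
  have hCSα : ∑ i ∈ Finset.range L, √(∑ m ∈ bM with ⌈(((m : ℕ) : ℝ) - M) * L / M⌉₊ - 1 = i, ‖α m‖ ^ 2)
      ≤ √L * √(∑ m ∈ bM, ‖α m‖ ^ 2) := by
    have h1 : (∑ i ∈ Finset.range L,
        √(∑ m ∈ bM with ⌈(((m : ℕ) : ℝ) - M) * L / M⌉₊ - 1 = i, ‖α m‖ ^ 2)) ^ 2 ≤
        L * ∑ m ∈ bM, ‖α m‖ ^ 2 := by
      calc (∑ i ∈ Finset.range L,
            √(∑ m ∈ bM with ⌈(((m : ℕ) : ℝ) - M) * L / M⌉₊ - 1 = i, ‖α m‖ ^ 2)) ^ 2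
          ≤ (Finset.range L).card * ∑ i ∈ Finset.range L,
              √(∑ m ∈ bM with ⌈(((m : ℕ) : ℝ) - M) * L / M⌉₊ - 1 = i, ‖α m‖ ^ 2) ^ 2 :=
            sq_sum_le_card_mul_sum_sq
        _ = L * ∑ m ∈ bM, ‖α m‖ ^ 2 := by
            rw [Finset.card_range,
              ← Finset.sum_fiberwise_of_maps_to hmapM (fun m => ‖α m‖ ^ 2)]
            congr 1
            refine Finset.sum_congr rfl fun i _ => ?_
            exact Real.sq_sqrt (Finset.sum_nonneg fun _ _ => sq_nonneg _)
    calc ∑ i ∈ Finset.range L, √(∑ m ∈ bM with ⌈(((m : ℕ) : ℝ) - M) * L / M⌉₊ - 1 = i, ‖α m‖ ^ 2)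
        = √((∑ i ∈ Finset.range L,
            √(∑ m ∈ bM with ⌈(((m : ℕ) : ℝ) - M) * L / M⌉₊ - 1 = i, ‖α m‖ ^ 2)) ^ 2) :=
          (Real.sqrt_sq (Finset.sum_nonneg fun _ _ => Real.sqrt_nonneg _)).symm
      _ ≤ √(L * ∑ m ∈ bM, ‖α m‖ ^ 2) := Real.sqrt_le_sqrt h1
      _ = √L * √(∑ m ∈ bM, ‖α m‖ ^ 2) := Real.sqrt_mul (Nat.cast_nonneg _) _
  have hCSβ : ∑ j ∈ Finset.range L, √(∑ n ∈ bN with ⌈(((n : ℕ) : ℝ) - N) * L / N⌉₊ - 1 = j, ‖β n‖ ^ 2)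
      ≤ √L * √(∑ n ∈ bN, ‖β n‖ ^ 2) := by
    have h1 : (∑ j ∈ Finset.range L,
        √(∑ n ∈ bN with ⌈(((n : ℕ) : ℝ) - N) * L / N⌉₊ - 1 = j, ‖β n‖ ^ 2)) ^ 2 ≤
        L * ∑ n ∈ bN, ‖β n‖ ^ 2 := by
      calc (∑ j ∈ Finset.range L,
            √(∑ n ∈ bN with ⌈(((n : ℕ) : ℝ) - N) * L / N⌉₊ - 1 = j, ‖β n‖ ^ 2)) ^ 2
          ≤ (Finset.range L).card * ∑ j ∈ Finset.range L,
              √(∑ n ∈ bN with ⌈(((n : ℕ) : ℝ) - N) * L / N⌉₊ - 1 = j, ‖β n‖ ^ 2) ^ 2 :=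
            sq_sum_le_card_mul_sum_sq
        _ = L * ∑ n ∈ bN, ‖β n‖ ^ 2 := by
            rw [Finset.card_range,
              ← Finset.sum_fiberwise_of_maps_to hmapN (fun n => ‖β n‖ ^ 2)]
            congr 1
            refine Finset.sum_congr rfl fun j _ => ?_
            exact Real.sq_sqrt (Finset.sum_nonneg fun _ _ => sq_nonneg _)
    calc ∑ j ∈ Finset.range L, √(∑ n ∈ bN with ⌈(((n : ℕ) : ℝ) - N) * L / N⌉₊ - 1 = j, ‖β n‖ ^ 2)
        = √((∑ j ∈ Finset.range L,
            √(∑ n ∈ bN with ⌈(((n : ℕ) : ℝ) - N) * L / N⌉₊ - 1 = j, ‖β n‖ ^ 2)) ^ 2) :=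
          (Real.sqrt_sq (Finset.sum_nonneg fun _ _ => Real.sqrt_nonneg _)).symm
      _ ≤ √(L * ∑ n ∈ bN, ‖β n‖ ^ 2) := Real.sqrt_le_sqrt h1
      _ = √L * √(∑ n ∈ bN, ‖β n‖ ^ 2) := Real.sqrt_mul (Nat.cast_nonneg _) _
  -- assembling
  calc ‖∑ m ∈ bM, ∑ n ∈ bN, F m n‖
      = ‖∑ i ∈ Finset.range L, ∑ j ∈ Finset.range L,
          ∑ m ∈ bM with ⌈(((m : ℕ) : ℝ) - M) * L / M⌉₊ - 1 = i,
            ∑ n ∈ bN with ⌈(((n : ℕ) : ℝ) - N) * L / N⌉₊ - 1 = j, F m n‖ := by rw [hdec]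
    _ ≤ ∑ i ∈ Finset.range L, ∑ j ∈ Finset.range L,
          ‖∑ m ∈ bM with ⌈(((m : ℕ) : ℝ) - M) * L / M⌉₊ - 1 = i,
            ∑ n ∈ bN with ⌈(((n : ℕ) : ℝ) - N) * L / N⌉₊ - 1 = j, F m n‖ :=
        (norm_sum_le _ _).trans (Finset.sum_le_sum fun i _ => norm_sum_le _ _)
    _ ≤ ∑ i ∈ Finset.range L, ∑ j ∈ Finset.range L,
          Real.exp (2 * π) * K * P₁ * P₂ *
            (√(∑ m ∈ bM with ⌈(((m : ℕ) : ℝ) - M) * L / M⌉₊ - 1 = i, ‖α m‖ ^ 2) *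
              √(∑ n ∈ bN with ⌈(((n : ℕ) : ℝ) - N) * L / N⌉₊ - 1 = j, ‖β n‖ ^ 2)) :=
        Finset.sum_le_sum fun i _ => Finset.sum_le_sum fun j _ => hbox i j
    _ = Real.exp (2 * π) * K * P₁ * P₂ *
          ((∑ i ∈ Finset.range L,
              √(∑ m ∈ bM with ⌈(((m : ℕ) : ℝ) - M) * L / M⌉₊ - 1 = i, ‖α m‖ ^ 2)) *
            (∑ j ∈ Finset.range L,
              √(∑ n ∈ bN with ⌈(((n : ℕ) : ℝ) - N) * L / N⌉₊ - 1 = j, ‖β n‖ ^ 2))) := by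
        rw [Finset.sum_mul_sum, Finset.mul_sum]
        refine Finset.sum_congr rfl fun i _ => ?_
        rw [Finset.mul_sum]
    _ ≤ Real.exp (2 * π) * K * P₁ * P₂ *
          ((√L * √(∑ m ∈ bM, ‖α m‖ ^ 2)) * (√L * √(∑ n ∈ bN, ‖β n‖ ^ 2))) := by
        gcongr
    _ = Real.exp (2 * π) * K * P₁ * P₂ *
          ((L : ℝ) * (√(∑ m ∈ bM, ‖α m‖ ^ 2) * √(∑ n ∈ bN, ‖β n‖ ^ 2))) := by
        rw [mul_mul_mul_comm (√(L : ℝ)) _ (√(L : ℝ)) _, Real.mul_self_sqrt hLr.le]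
    _ ≤ Real.exp (2 * π) * K * P₁ * P₂ *
          ((2 * (1 + Y) ^ (1 / 2 : ℝ)) * (√(∑ m ∈ bM, ‖α m‖ ^ 2) * √(∑ n ∈ bN, ‖β n‖ ^ 2))) := by
        gcongr
    _ = 2 * Real.exp (2 * π) * K * (1 + Y) ^ (1 / 2 : ℝ) * P₁ * P₂ *
          √(∑ m ∈ bM, ‖α m‖ ^ 2) * √(∑ n ∈ bN, ‖β n‖ ^ 2) := by ring

/-- **Range bookkeeping with the exponent `3/4`.**  As `DFI_shape_of_BC_and_trivial`, but with the
weaker Bettin–Chandee-type hypothesis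
`B ≤ K F (1 + R/MN)^{3/4} ((MN)^{7/20+ε/2}(M+N)^{1/4} + (MN)^{3/8+ε/2}(M+N)^{1/8})`
(the exponent that arises when the twist is removed by box splitting, `(1 + ·)^{1/2}·(1 + ·)^{1/4}`):
still `B ≤ (2 + 8K) F (R + MN)^{3/8}(M+N)^{11/48+ε}`.  In the delicate range (`MN < R`,
`R^{3/8}(M+N)^{11/48} < (MN)^{1/2}`) the margin is `(M+N)^{-1/120}`. [folklore] -/
theorem DFI_shape_of_BC34_and_trivial {ε K M N R F B : ℝ} (hε : 0 < ε) (hK : 0 < K)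
    (hM : 1 / 2 ≤ M) (hN : 1 / 2 ≤ N) (hR : 1 ≤ R) (hF : 0 ≤ F)
    (htriv : B ≤ 2 * Real.sqrt (M * N) * F)
    (hBC : B ≤ K * F * (1 + R / (M * N)) ^ (3 / 4 : ℝ) *
      ((M * N) ^ (7 / 20 + ε / 2) * (M + N) ^ (1 / 4 : ℝ) +
        (M * N) ^ (3 / 8 + ε / 2) * (M + N) ^ (1 / 8 : ℝ))) :
    B ≤ (2 + 8 * K) * F * (R + M * N) ^ (3 / 8 : ℝ) * (M + N) ^ (11 / 48 + ε) := by
  have hM0 : 0 < M := by linarith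
  have hN0 : 0 < N := by linarith
  have hQ0 : 0 < M * N := mul_pos hM0 hN0
  have hP1 : 1 ≤ M + N := by linarith
  have hP0 : 0 < M + N := by linarith
  have hR0 : 0 < R := by linarith
  obtain ⟨q, hq⟩ : ∃ q : ℝ, q = Real.log (M * N) := ⟨_, rfl⟩
  obtain ⟨p, hp⟩ : ∃ p : ℝ, p = Real.log (M + N) := ⟨_, rfl⟩
  obtain ⟨r, hr⟩ : ∃ r : ℝ, r = Real.log R := ⟨_, rfl⟩
  have hp0 : 0 ≤ p := hp ▸ Real.log_nonneg hP1
  have hr0 : 0 ≤ r := hr ▸ Real.log_nonneg hR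
  have hqp : q ≤ 2 * p := by
    have h1 : M * N ≤ (M + N) ^ 2 := by nlinarith [sq_nonneg (M - N)]
    have h2 : Real.log (M * N) ≤ Real.log ((M + N) ^ 2) := Real.log_le_log hQ0 h1
    rw [Real.log_pow, ← hq, ← hp] at h2
    push_cast at h2
    linarith
  have hlog4 : Real.log 4 ≤ 2 := by
    have h2 : Real.log 4 = 2 * Real.log 2 := by
      rw [show (4 : ℝ) = 2 ^ 2 by norm_num, Real.log_pow]; push_cast; ring
    rw [h2]
    have := Real.log_two_lt_d9
    linarith
  have hpq : p - 2 ≤ q := by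
    have h1 : (M + N) / 4 ≤ M * N := by
      rcases le_total M N with h | h
      · nlinarith
      · nlinarith
    have h2 : Real.log ((M + N) / 4) ≤ Real.log (M * N) := Real.log_le_log (by positivity) h1
    rw [Real.log_div hP0.ne' (by norm_num), ← hp, ← hq] at h2
    linarith
  have hεq : ε / 2 * q ≤ ε * p := by
    have := mul_le_mul_of_nonneg_left hqp (by positivity : (0 : ℝ) ≤ ε / 2)
    linarith
  have hεp : 0 ≤ ε * p := mul_nonneg hε.le hp0
  have eQ : ∀ a : ℝ, (M * N) ^ a = Real.exp (a * q) := fun a => by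
    rw [Real.rpow_def_of_pos hQ0, mul_comm, hq]
  have eP : ∀ a : ℝ, (M + N) ^ a = Real.exp (a * p) := fun a => by
    rw [Real.rpow_def_of_pos hP0, mul_comm, hp]
  have eR : ∀ a : ℝ, R ^ a = Real.exp (a * r) := fun a => by
    rw [Real.rpow_def_of_pos hR0, mul_comm, hr]
  have esqrt : Real.sqrt (M * N) = Real.exp (1 / 2 * q) := by
    rw [Real.sqrt_eq_rpow, eQ]
  set G : ℝ := (R + M * N) ^ (3 / 8 : ℝ) * (M + N) ^ (11 / 48 + ε) with hG
  have hG_r : Real.exp (3 / 8 * r + (11 / 48 + ε) * p) ≤ G := by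
    rw [Real.exp_add, hG, ← eR, ← eP]
    gcongr
    linarith
  have hG_q : Real.exp (3 / 8 * q + (11 / 48 + ε) * p) ≤ G := by
    rw [Real.exp_add, hG, ← eQ, ← eP]
    gcongr
    linarith
  have hKF : 0 ≤ K * F := mul_nonneg hK.le hF
  -- constants: `2^{3/4} ≤ 2`, `e^{1/20} ≤ 3`
  have h234 : (2 : ℝ) ^ (3 / 4 : ℝ) ≤ 2 := by
    calc (2 : ℝ) ^ (3 / 4 : ℝ) ≤ (2 : ℝ) ^ (1 : ℝ) :=
          Real.rpow_le_rpow_of_exponent_le (by norm_num) (by norm_num)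
      _ = 2 := Real.rpow_one 2
  have hexp : Real.exp (1 / 20) ≤ 3 := by
    have h1 : Real.exp (1 / 20) ≤ Real.exp 1 := Real.exp_le_exp.mpr (by norm_num)
    have h2 := Real.exp_one_lt_d9
    linarith
  have eT : (M * N) ^ (7 / 20 + ε / 2) * (M + N) ^ (1 / 4 : ℝ) +
      (M * N) ^ (3 / 8 + ε / 2) * (M + N) ^ (1 / 8 : ℝ) =
      Real.exp ((7 / 20 + ε / 2) * q + 1 / 4 * p) + Real.exp ((3 / 8 + ε / 2) * q + 1 / 8 * p) := by
    rw [eQ, eP, eQ, eP, ← Real.exp_add, ← Real.exp_add]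
  rw [eT] at hBC
  by_cases h1 : R ≤ M * N
  · -- Case `R ≤ MN`
    have hfac : (1 + R / (M * N)) ^ (3 / 4 : ℝ) ≤ 2 := by
      have h2 : 1 + R / (M * N) ≤ 2 := by
        have h3 : R / (M * N) ≤ 1 := (div_le_one hQ0).mpr h1
        linarith only [h3]
      exact (Real.rpow_le_rpow (by positivity) h2 (by norm_num)).trans h234
    have hT₁ : Real.exp ((7 / 20 + ε / 2) * q + 1 / 4 * p) ≤
        Real.exp (1 / 20) * Real.exp (3 / 8 * q + (11 / 48 + ε) * p) := by
      rw [← Real.exp_add]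
      exact Real.exp_le_exp.mpr (by linarith only [hpq, hεq, hp0, hεp])
    have hT₂ : Real.exp ((3 / 8 + ε / 2) * q + 1 / 8 * p) ≤
        Real.exp (3 / 8 * q + (11 / 48 + ε) * p) :=
      Real.exp_le_exp.mpr (by linarith only [hεq, hp0, hεp])
    set X : ℝ := Real.exp (3 / 8 * q + (11 / 48 + ε) * p) with hX
    have hX0 : 0 ≤ X := (Real.exp_pos _).le
    calc B ≤ K * F * (1 + R / (M * N)) ^ (3 / 4 : ℝ) *
          (Real.exp ((7 / 20 + ε / 2) * q + 1 / 4 * p) +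
            Real.exp ((3 / 8 + ε / 2) * q + 1 / 8 * p)) := hBC
      _ ≤ K * F * 2 * (Real.exp (1 / 20) * X + X) := by gcongr
      _ ≤ K * F * 2 * (3 * X + X) := by gcongr
      _ = 8 * (K * F) * X := by ring
      _ ≤ (2 + 8 * K) * F * X := by
          linarith only [mul_nonneg hKF hX0, mul_nonneg hF hX0]
      _ ≤ (2 + 8 * K) * F * G := by gcongr
      _ = _ := by rw [hG]; ring
  · have h1' : M * N < R := not_le.mp h1
    have hqr : q ≤ r := by
      rw [hq, hr]; exact Real.log_le_log hQ0 h1'.le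
    by_cases h2 : 1 / 2 * q ≤ 3 / 8 * r + 11 / 48 * p
    · -- the trivial bound suffices
      calc B ≤ 2 * Real.sqrt (M * N) * F := htriv
        _ = 2 * F * Real.exp (1 / 2 * q) := by rw [esqrt]; ring
        _ ≤ 2 * F * Real.exp (3 / 8 * r + (11 / 48 + ε) * p) := by
            gcongr 2 * F * ?_
            exact Real.exp_le_exp.mpr (by linarith only [h2, hεp])
        _ ≤ 2 * F * G := by gcongr
        _ ≤ (2 + 8 * K) * F * G := by
            have h3 : 0 ≤ F * G := mul_nonneg hF (by positivity)
            have h4 : 0 ≤ K * (F * G) := mul_nonneg hK.le h3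
            linarith only [h3, h4]
        _ = _ := by rw [hG]; ring
    · -- `MN < R`, `R^{3/8}(M+N)^{11/48} < (MN)^{1/2}`
      have h2' : 3 / 8 * r + 11 / 48 * p < 1 / 2 * q := not_le.mp h2
      have hfac : (1 + R / (M * N)) ^ (3 / 4 : ℝ) ≤ 2 * Real.exp (3 / 4 * (r - q)) := by
        have hRQ : R / (M * N) = Real.exp (r - q) := by
          rw [Real.exp_sub, hr, hq, Real.exp_log hR0, Real.exp_log hQ0]
        have h3 : 1 + R / (M * N) ≤ 2 * Real.exp (r - q) := by
          have h4 : 1 ≤ Real.exp (r - q) := Real.one_le_exp (by linarith only [hqr])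
          rw [hRQ]; linarith only [h4]
        calc (1 + R / (M * N)) ^ (3 / 4 : ℝ) ≤ (2 * Real.exp (r - q)) ^ (3 / 4 : ℝ) :=
              Real.rpow_le_rpow (by positivity) h3 (by norm_num)
          _ = (2 : ℝ) ^ (3 / 4 : ℝ) * Real.exp (3 / 4 * (r - q)) := by
              rw [Real.mul_rpow (by norm_num) (Real.exp_pos _).le, ← Real.exp_mul, mul_comm (r - q)]
          _ ≤ 2 * Real.exp (3 / 4 * (r - q)) := by gcongr
      set X : ℝ := Real.exp (3 / 8 * r + (11 / 48 + ε) * p) with hX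
      have hX0 : 0 ≤ X := (Real.exp_pos _).le
      have hT₁ : Real.exp (3 / 4 * (r - q)) * Real.exp ((7 / 20 + ε / 2) * q + 1 / 4 * p) ≤ X := by
        rw [← Real.exp_add]
        exact Real.exp_le_exp.mpr (by linarith only [h2', hεq, hqp, hp0, hεp])
      have hT₂ : Real.exp (3 / 4 * (r - q)) * Real.exp ((3 / 8 + ε / 2) * q + 1 / 8 * p) ≤ X := by
        rw [← Real.exp_add]
        exact Real.exp_le_exp.mpr (by linarith only [h2', hεq, hqp, hp0, hεp])
      calc B ≤ K * F * (1 + R / (M * N)) ^ (3 / 4 : ℝ) *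
            (Real.exp ((7 / 20 + ε / 2) * q + 1 / 4 * p) +
              Real.exp ((3 / 8 + ε / 2) * q + 1 / 8 * p)) := hBC
        _ ≤ K * F * (2 * Real.exp (3 / 4 * (r - q))) *
            (Real.exp ((7 / 20 + ε / 2) * q + 1 / 4 * p) +
              Real.exp ((3 / 8 + ε / 2) * q + 1 / 8 * p)) := by gcongr
        _ = K * F * 2 *
            (Real.exp (3 / 4 * (r - q)) * Real.exp ((7 / 20 + ε / 2) * q + 1 / 4 * p) +
              Real.exp (3 / 4 * (r - q)) * Real.exp ((3 / 8 + ε / 2) * q + 1 / 8 * p)) := by ring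
        _ ≤ K * F * 2 * (X + X) := by gcongr
        _ = 4 * (K * F) * X := by ring
        _ ≤ (2 + 8 * K) * F * X := by
            linarith only [mul_nonneg hKF hX0, mul_nonneg hF hX0]
        _ ≤ (2 + 8 * K) * F * G := by gcongr
        _ = _ := by rw [hG]; ring

/-- `(1 + x)^{1/4} ≤ (1 + x)^{3/4}` and `(1+x)^{1/2} (1+x)^{1/4} = (1+x)^{3/4}` bookkeeping:
for `y ≥ 1`, `y^{1/4} ≤ y^{3/4}`. [folklore] -/
theorem DFI_rpow_quarter_le_three_quarters {y : ℝ} (hy : 1 ≤ y) :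
    y ^ (1 / 4 : ℝ) ≤ y ^ (3 / 4 : ℝ) :=
  Real.rpow_le_rpow_of_exponent_le hy (by norm_num)

/-- **From Bettin–Chandee (7.1) in the range `M ≥ N` (untwisted) to Duke–Friedlander–Iwaniec's
Theorem 2 in all ranges.**  Suppose that for every `ε > 0` there is `K` with, for all
`1/2 ≤ N ≤ M`, `k ≠ 0` and all `α_m` (`M < m ≤ 2M`), `β_n` (`N < n ≤ 2N`),
`|∑∑_{(m,n)=1} α_m β_n e(k m̄/n)| ≤ K ‖α‖‖β‖ (MN)^ε (1 + |k|/MN)^{1/4} (M^{1/2}N^{3/8} + M^{3/5}N^{7/20})`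
(Bettin–Chandee (7.1), case `A = 1`, `ϑ = k`, range `M ≥ N`, in the tree's conventions).  Then for
every `ε > 0` there is `K'` with, for all `M, N ≥ 1/2`, `k ≠ 0`, `α`, `β`,
`|∑∑_{(m,n)=1} α_m β_n e(k m̄/n)| ≤ K' ‖α‖‖β‖ (|k| + MN)^{3/8} (M+N)^{11/48+ε}`
(the case `X = 0` of the named fact).  For `M < N` the variables are swapped by reciprocity
(`DFI_bilinear_eq_swap`), the resulting twist `e(k/mn)` is removed by box splitting
(`DFI_twisted_le_of_untwisted`, cost `(1 + |k|/MN)^{1/2}`), and the total exponent `3/4` is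
handled by `DFI_shape_of_BC34_and_trivial` — so NO twisted estimates (Remark 2 of the source) are
needed. [cite: BettinChandee2018, §7] [cite: DukeFriedlanderIwaniec1997, Theorem 2] -/
theorem DFI_untwisted_allMN_of_BC71_MgeN
    (h : ∀ ε : ℝ, 0 < ε → ∃ K : ℝ, 0 < K ∧
      ∀ (M N : ℝ), 1 / 2 ≤ N → N ≤ M → ∀ (k : ℤ), k ≠ 0 → ∀ (α β : ℕ → ℂ),
        (∀ m : ℕ, α m ≠ 0 → M < m ∧ (m : ℝ) ≤ 2 * M) →
        (∀ n : ℕ, β n ≠ 0 → N < n ∧ (n : ℝ) ≤ 2 * N) →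
        ‖∑ m ∈ Icc 1 ⌊2 * M⌋₊, ∑ n ∈ Icc 1 ⌊2 * N⌋₊,
            if m.Coprime n then
              α m * β n * Complex.exp (2 * Real.pi * Complex.I *
                ((k : ℂ) * ((((m : ZMod n)⁻¹).val : ℕ) : ℂ) / (n : ℂ)))
            else 0‖ ≤
          K * Real.sqrt (∑ m ∈ Icc 1 ⌊2 * M⌋₊, ‖α m‖ ^ 2) *
            Real.sqrt (∑ n ∈ Icc 1 ⌊2 * N⌋₊, ‖β n‖ ^ 2) * (M * N) ^ ε *
            (1 + |(k : ℝ)| / (M * N)) ^ (1 / 4 : ℝ) *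
            (M ^ (1 / 2 : ℝ) * N ^ (3 / 8 : ℝ) + M ^ (3 / 5 : ℝ) * N ^ (7 / 20 : ℝ))) :
    ∀ ε : ℝ, 0 < ε → ∃ K : ℝ, 0 < K ∧
      ∀ (M N : ℝ), 1 / 2 ≤ M → 1 / 2 ≤ N → ∀ (k : ℤ), k ≠ 0 → ∀ (α β : ℕ → ℂ),
        (∀ m : ℕ, α m ≠ 0 → M < m ∧ (m : ℝ) ≤ 2 * M) →
        (∀ n : ℕ, β n ≠ 0 → N < n ∧ (n : ℝ) ≤ 2 * N) →
        ‖∑ m ∈ Icc 1 ⌊2 * M⌋₊, ∑ n ∈ Icc 1 ⌊2 * N⌋₊,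
            if m.Coprime n then
              α m * β n * Complex.exp (2 * Real.pi * Complex.I *
                ((k : ℂ) * ((((m : ZMod n)⁻¹).val : ℕ) : ℂ) / (n : ℂ)))
            else 0‖ ≤
          K * Real.sqrt (∑ m ∈ Icc 1 ⌊2 * M⌋₊, ‖α m‖ ^ 2) *
            Real.sqrt (∑ n ∈ Icc 1 ⌊2 * N⌋₊, ‖β n‖ ^ 2) *
            (|(k : ℝ)| + M * N) ^ (3 / 8 : ℝ) * (M + N) ^ (11 / 48 + ε) := by
  intro ε hε
  obtain ⟨K, hK, hB⟩ := h (ε / 2) (by positivity)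
  set K₂ : ℝ := 2 * Real.exp (2 * π) * K with hK₂
  have hK₂0 : 0 < K₂ := by positivity
  have hKK₂ : K ≤ K₂ := by
    have h1 : 1 ≤ 2 * Real.exp (2 * π) := by
      have := Real.add_one_le_exp (2 * π)
      have : 0 < 2 * π := by positivity
      linarith
    calc K = 1 * K := (one_mul K).symm
      _ ≤ 2 * Real.exp (2 * π) * K := by gcongr
  refine ⟨2 + 8 * K₂, by positivity, ?_⟩
  intro M N hM hN k hk α β hα hβ
  have hM0 : 0 < M := by linarith
  have hN0 : 0 < N := by linarith
  have hR : (1 : ℝ) ≤ |(k : ℝ)| := by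
    rw [← Int.cast_abs]; exact_mod_cast Int.one_le_abs hk
  have htriv := DFI_bilinear_trivial_bound hM0.le hN0.le k α β
  set nα := Real.sqrt (∑ m ∈ Icc 1 ⌊2 * M⌋₊, ‖α m‖ ^ 2) with hnα
  set nβ := Real.sqrt (∑ n ∈ Icc 1 ⌊2 * N⌋₊, ‖β n‖ ^ 2) with hnβ
  set B := ‖∑ m ∈ Icc 1 ⌊2 * M⌋₊, ∑ n ∈ Icc 1 ⌊2 * N⌋₊,
    if m.Coprime n then
      α m * β n * Complex.exp (2 * Real.pi * Complex.I *
        ((k : ℂ) * ((((m : ZMod n)⁻¹).val : ℕ) : ℂ) / (n : ℂ)))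
    else 0‖ with hBdef
  have hnα0 : 0 ≤ nα := Real.sqrt_nonneg _
  have hnβ0 : 0 ≤ nβ := Real.sqrt_nonneg _
  set W : ℝ := 1 + |(k : ℝ)| / (M * N) with hW
  have hW1 : 1 ≤ W := by
    have h0 : 0 ≤ |(k : ℝ)| / (M * N) := by positivity
    show 1 ≤ 1 + |(k : ℝ)| / (M * N)
    exact le_add_of_nonneg_right h0
  set RHS : ℝ := (M * N) ^ (7 / 20 + ε / 2) * (M + N) ^ (1 / 4 : ℝ) +
    (M * N) ^ (3 / 8 + ε / 2) * (M + N) ^ (1 / 8 : ℝ) with hRHS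
  have hRHS0 : 0 ≤ RHS := by positivity
  -- Bettin–Chandee shape with exponent 3/4, in both ranges
  have hBC34 : B ≤ K₂ * (nα * nβ) * W ^ (3 / 4 : ℝ) * RHS := by
    rcases le_or_gt N M with hNM | hMN
    · -- `N ≤ M`: directly
      have h1 := hB M N hN hNM k hk α β hα hβ
      have h72 := DFI_terms72_le (ε / 2) hM0 hN0
      have hW14 : W ^ (1 / 4 : ℝ) ≤ W ^ (3 / 4 : ℝ) := DFI_rpow_quarter_le_three_quarters hW1
      calc B ≤ _ := h1
        _ = K * (nα * nβ) * W ^ (1 / 4 : ℝ) *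
            ((M * N) ^ (ε / 2) * (M ^ (1 / 2 : ℝ) * N ^ (3 / 8 : ℝ) + M ^ (3 / 5 : ℝ) * N ^ (7 / 20 : ℝ))) := by
            rw [hW]; ring
        _ ≤ K₂ * (nα * nβ) * W ^ (3 / 4 : ℝ) * RHS := by gcongr
    · -- `M < N`: swap, untwist, and the hypothesis at `(N, M)` with numerator `-k`
      rw [hBdef, DFI_bilinear_eq_swap]
      have hk' : (-k : ℤ) ≠ 0 := neg_ne_zero.mpr hk
      have habs : |((-k : ℤ) : ℝ)| = |(k : ℝ)| := by rw [Int.cast_neg, abs_neg]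
      -- the untwisted hypothesis at the box `(N, M)`, numerator `-k`, for all coefficients
      have hB' : ∀ (α' β' : ℕ → ℂ),
          (∀ m : ℕ, α' m ≠ 0 → N < m ∧ (m : ℝ) ≤ 2 * N) →
          (∀ n : ℕ, β' n ≠ 0 → M < n ∧ (n : ℝ) ≤ 2 * M) →
          ‖∑ m ∈ Finset.Icc 1 ⌊2 * N⌋₊, ∑ n ∈ Finset.Icc 1 ⌊2 * M⌋₊,
              if Nat.Coprime m n then
                α' m * β' n * cexp (2 * π * I *
                  (((-k : ℤ) : ℂ) * ((((m : ZMod n)⁻¹).val : ℕ) : ℂ) / (n : ℂ)))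
              else 0‖ ≤
            K * √(∑ m ∈ Finset.Icc 1 ⌊2 * N⌋₊, ‖α' m‖ ^ 2) *
              √(∑ n ∈ Finset.Icc 1 ⌊2 * M⌋₊, ‖β' n‖ ^ 2) *
              ((N * M) ^ (ε / 2) * (1 + |(k : ℝ)| / (N * M)) ^ (1 / 4 : ℝ)) *
              (N ^ (1 / 2 : ℝ) * M ^ (3 / 8 : ℝ) + N ^ (3 / 5 : ℝ) * M ^ (7 / 20 : ℝ)) := by
        intro α' β' hα' hβ'
        have h2 := hB N M hM hMN.le (-k) hk' α' β' hα' hβ'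
        rw [habs] at h2
        calc _ ≤ _ := h2
          _ = _ := by ring
      have hP₁ : 0 ≤ (N * M) ^ (ε / 2) * (1 + |(k : ℝ)| / (N * M)) ^ (1 / 4 : ℝ) := by positivity
      have hP₂ : 0 ≤ N ^ (1 / 2 : ℝ) * M ^ (3 / 8 : ℝ) + N ^ (3 / 5 : ℝ) * M ^ (7 / 20 : ℝ) := by
        positivity
      have h3 := DFI_twisted_le_of_untwisted hN hM hK.le hP₁ hP₂ hB' (k : ℝ) β α hβ hα
      have h72 := DFI_terms72_le (ε / 2) hN0 hM0
      rw [mul_comm N M, add_comm N M] at h72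
      -- `(1 + |k|/MN)^{1/2} (1 + |k|/MN)^{1/4} = W^{3/4}`
      have hW34 : (1 + |((k : ℝ))| / (N * M)) ^ (1 / 2 : ℝ) * (1 + |(k : ℝ)| / (N * M)) ^ (1 / 4 : ℝ) =
          W ^ (3 / 4 : ℝ) := by
        rw [mul_comm N M, ← hW, ← Real.rpow_add (by linarith)]
        norm_num
      calc _ ≤ _ := h3
        _ = K₂ * (nα * nβ) *
            ((1 + |((k : ℝ))| / (N * M)) ^ (1 / 2 : ℝ) * (1 + |(k : ℝ)| / (N * M)) ^ (1 / 4 : ℝ)) *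
            ((N * M) ^ (ε / 2) * (N ^ (1 / 2 : ℝ) * M ^ (3 / 8 : ℝ) + N ^ (3 / 5 : ℝ) * M ^ (7 / 20 : ℝ))) := by
            rw [hK₂]; ring
        _ = K₂ * (nα * nβ) * W ^ (3 / 4 : ℝ) *
            ((M * N) ^ (ε / 2) * (N ^ (1 / 2 : ℝ) * M ^ (3 / 8 : ℝ) + N ^ (3 / 5 : ℝ) * M ^ (7 / 20 : ℝ))) := by
            rw [hW34, mul_comm N M]
        _ ≤ K₂ * (nα * nβ) * W ^ (3 / 4 : ℝ) * RHS := by gcongr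
  have htriv' : B ≤ 2 * Real.sqrt (M * N) * (nα * nβ) := by
    calc B ≤ _ := htriv
      _ = _ := by ring
  have hmain := DFI_shape_of_BC34_and_trivial hε hK₂0 hM hN hR (mul_nonneg hnα0 hnβ0) htriv'
    (by rw [hW] at hBC34; rw [hRHS] at hBC34; exact hBC34)
  calc B ≤ _ := hmain
    _ = _ := by ring

/-- **The named fact from Bettin–Chandee (7.1), untwisted, in the range `M ≥ N`.**  The hypothesis
of `DFI_untwisted_allMN_of_BC71_MgeN` (Bettin–Chandee's Theorem 1 for `A = 1` in the range
`M ≥ N`, in the form (7.1), WITHOUT the twist of their Remark 2) implies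
`DukeFriedlanderIwaniec1997_bilinearKloostermanFractions`.  What remains to be proved of
Bettin–Chandee's paper for the named fact is therefore exactly §§2–6 leading to (7.1) for
`M ≥ N`, for the untwisted second moment `𝓒_b` (`kfC` of the tree).
[cite: BettinChandee2018, §7] [cite: DukeFriedlanderIwaniec1997, Theorem 2] -/
theorem DukeFriedlanderIwaniec1997_bilinearKloostermanFractions_of_BC71_MgeN
    (h : ∀ ε : ℝ, 0 < ε → ∃ K : ℝ, 0 < K ∧
      ∀ (M N : ℝ), 1 / 2 ≤ N → N ≤ M → ∀ (k : ℤ), k ≠ 0 → ∀ (α β : ℕ → ℂ),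
        (∀ m : ℕ, α m ≠ 0 → M < m ∧ (m : ℝ) ≤ 2 * M) →
        (∀ n : ℕ, β n ≠ 0 → N < n ∧ (n : ℝ) ≤ 2 * N) →
        ‖∑ m ∈ Icc 1 ⌊2 * M⌋₊, ∑ n ∈ Icc 1 ⌊2 * N⌋₊,
            if m.Coprime n then
              α m * β n * Complex.exp (2 * Real.pi * Complex.I *
                ((k : ℂ) * ((((m : ZMod n)⁻¹).val : ℕ) : ℂ) / (n : ℂ)))
            else 0‖ ≤
          K * Real.sqrt (∑ m ∈ Icc 1 ⌊2 * M⌋₊, ‖α m‖ ^ 2) *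
            Real.sqrt (∑ n ∈ Icc 1 ⌊2 * N⌋₊, ‖β n‖ ^ 2) * (M * N) ^ ε *
            (1 + |(k : ℝ)| / (M * N)) ^ (1 / 4 : ℝ) *
            (M ^ (1 / 2 : ℝ) * N ^ (3 / 8 : ℝ) + M ^ (3 / 5 : ℝ) * N ^ (7 / 20 : ℝ))) :
    DukeFriedlanderIwaniec1997_bilinearKloostermanFractions :=
  DukeFriedlanderIwaniec1997_bilinearKloostermanFractions_of_untwisted
    (DFI_untwisted_allMN_of_BC71_MgeN h)

end Literature.NumberTheory.LFunctions

end
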